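import Literature.AlgebraicGeometry.Modules.PullbackPushforwardGroupAction
import Literature.AlgebraicGeometry.Modules.PullbackFrame
import HarnessLib

/-!
# The descent identity on a framed Galois chart: invariant sections of `f_*f^*M` come from `M`

Let `f : X → Y` be a morphism of schemes, `τ : K → (X ⟶ X)` self-maps over `Y` (`τ x ≫ f = f`) acting on `f_*f^*M` by the canonical
action `act_x` of `Modules/PullbackPushforwardGroupAction` (`act_x(c · η(m)) = σ_x(c) · η(m)`, `σ_x = (τ x)♯`), and `U ⊆ Y` an open
over which `M` is FRAMED (`e : 𝒪_U^I ≅ M|_U`, basis sections `b_i`). Mumford, *Abelian Varieties*, §7 Thm. 4 ∕ §12 Thm. 1 (descent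
along a free finite-group quotient `π : X → X∕G`: `π^*` is an equivalence onto `G`-sheaves, so the `G`-invariants of `π_*π^*M` are `M`)
read on such a chart:

* `twistAction_app_sum_smul_unitSection` — in frame coordinates `act_x(∑ c_i · η(b_i)) = ∑ σ_x(c_i) · η(b_i)`;
* `eq_sum_pulledCoord_smul_unitSection`, `pulledCoord_sum_smul_unitSection` — every section of `f^*M` over `f⁻¹U` is `∑ λ_i(s) · η(b_i)`
  and the dual sections `λ_i` of the pulled-back frame read off the coordinates (`Modules/PullbackFrame`);
* **`exists_unitSection_eq_of_twistAction_invariant`** — if the invariant functions on `f⁻¹U` descend (`ChartInvariants`: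
  `Γ(f⁻¹U, 𝒪_X)^K = f♯Γ(U, 𝒪_Y)`, the Chase–Harrison–Rosenberg chart hypothesis of `Modules/PullbackPushforwardGaloisChart`), then every
  section of `f_*f^*M` over `U` fixed by all `act_x` is `η(m)` for some `m ∈ Γ(U, M)`: its coordinates are invariant, hence descend;
* **`unitSection_injective_of_frame`** — if `f♯_U` is injective, `η : Γ(U, M) → Γ(f⁻¹U, f^*M)` is injective (coordinates pull back by
  `f♯`), so the descended section is UNIQUE: `(f_*f^*M)^K = η(M) ≅ M` on the chart.

The gluing of these chart statements into `(f_*f^*M)^K ≅ M` over all of `Y` needs the Galois charts to be inherited by principal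
affine opens (invariants of a localisation) — the sequel. Everything is proved; no named facts, no `sorry`. Written for Hodge road №4
(crux stmt-HodgeConjecture-26512, lens line N′, the descent-identity face of (N-U); director-hodge (M5)-lite).

## References

* D. Mumford, *Abelian Varieties* (1970), §7 Thm. 4 (p. 72), §12 Thm. 1 (p. 111). [MumfordAV1970]
* R. Hartshorne, *Algebraic Geometry*, GTM 52 (1977), II.5 (p. 110). [Hartshorne1977]
* C. Greither, *Cyclic Galois extensions of commutative rings*, LNM 1534 (1992), Ch. 0 (invariants on Galois charts). [Greither1992CyclicGalois]
-/

noncomputable section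

-- `TopCat.Presheaf`/`Scheme.Modules` are not reducible (as in Mathlib's `AlgebraicGeometry/Modules/Sheaf.lean`).
set_option backward.isDefEq.respectTransparency false

open CategoryTheory AlgebraicGeometry TopologicalSpace Opposite
open AlgebraicGeometry.Scheme.Modules

universe u

namespace Literature.AlgebraicGeometry.Modules

open Literature.AlgebraicGeometry.Motives

variable {X Y : Scheme.{u}} (f : X ⟶ Y) {K : Type u} (τ : K → (X ⟶ X)) (hτ : ∀ x, τ x ≫ f = f)
  (M : Y.Modules)

/-! ## §2 The descent identity on a framed Galois chart: invariant sections of `f_*f^*M` come from `M` -/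

section Descent

variable {U : Y.Opens} {I : Type u} [Fintype I] (e : SheafOfModules.free I ≅ M.over U)

/-- The action is additive on sections (sums). [cite: MumfordAV1970, §7 Thm. 4 (p. 72)] -/
theorem twistAction_app_sum (x : K) {ι : Type*} (t : Finset ι)
    (s : ι → Γ((pushforward f).obj ((pullback f).obj M), U)) :
    (twistAction f τ hτ M x).app U (∑ i ∈ t, s i) = ∑ i ∈ t, (twistAction f τ hτ M x).app U (s i) :=
  map_sum ((twistAction f τ hτ M x).app U).hom s t

/-- **The action in frame coordinates**: for `s = ∑_i c_i · η(b_i)` (`b_i` a frame of `M|_U`, `c_i ∈ Γ(f⁻¹U, 𝒪_X)`),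
`act_x(s) = ∑_i σ_x(c_i) · η(b_i)`. [cite: MumfordAV1970, §7 Thm. 4 (p. 72)] -/
theorem twistAction_app_sum_smul_unitSection (x : K) (c : I → Γ(X, f ⁻¹ᵁ U)) :
    (twistAction f τ hτ M x).app U (∑ i, c i • unitSection f M U (basisSection e i) :) =
      (∑ i, twistRingHom f τ hτ U x (c i) • unitSection f M U (basisSection e i) :) := by
  rw [show (∑ i, c i • unitSection f M U (basisSection e i) :) =
    ∑ i, (c i • unitSection f M U (basisSection e i) : Γ((pushforward f).obj ((pullback f).obj M), U)) from rfl,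
    twistAction_app_sum]
  exact Finset.sum_congr rfl fun i _ => twistAction_app_smul_unitSection f τ hτ M x U (c i) (basisSection e i)

/-- **Frame expansion of a section of `f^*M` over `f⁻¹U`**: `s = ∑_i λ_i(s) · η(b_i)` with `λ_i` the dual sections of the pulled-back frame
(`Modules/PullbackFrame.eq_sum_dualSection_smul` at the identity inclusion). [cite: Hartshorne1977, II.5 (p. 110)] -/
theorem eq_sum_pulledCoord_smul_unitSection (s : Γ((pullback f).obj M, f ⁻¹ᵁ U)) :
    s = ∑ i, pulledCoord f e (𝟙 (f ⁻¹ᵁ U)) s i • unitSection f M U (basisSection e i) := by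
  have h := eq_sum_dualSection_smul f e (𝟙 (f ⁻¹ᵁ U)) s
  simp only [op_id, CategoryTheory.Functor.map_id] at h
  exact h

/-- **The dual sections read off frame coordinates**: `λ_j(∑_i c_i · η(b_i)) = c_j`. [cite: Hartshorne1977, II.5 (p. 110)] -/
theorem pulledCoord_sum_smul_unitSection [DecidableEq I] (c : I → Γ(X, f ⁻¹ᵁ U)) (j : I) :
    pulledCoord f e (𝟙 (f ⁻¹ᵁ U)) (∑ i, c i • unitSection f M U (basisSection e i)) j = c j := by
  rw [pulledCoord_def, appLE_sum_right]
  simp_rw [appLE_smul_right, appLE_dualSection_unitSection f e j]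
  simp only [smul_eq_mul, mul_ite, mul_one, mul_zero, Finset.sum_ite_eq', Finset.mem_univ, if_true]

/-- **THE DESCENT IDENTITY ON A FRAMED GALOIS CHART (existence)**: if `M|_U` is framed and the invariant functions on `f⁻¹U` descend
(`ChartInvariants`: `Γ(f⁻¹U, 𝒪_X)^K = f♯Γ(U, 𝒪_Y)`), then every section of `f_*f^*M` over `U` fixed by all `act_x` is `η(m)` for some
`m ∈ Γ(U, M)` — `(f_*f^*M)^K ⊆ η(M)` on the chart (Mumford: `π^*` identifies `𝒪_{X∕G}`-modules with `G`-sheaves; here for the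
modules `π^*M`). [cite: MumfordAV1970, §7 Thm. 4 (p. 72) and §12 Thm. 1 (p. 111)] -/
theorem exists_unitSection_eq_of_twistAction_invariant (e : SheafOfModules.free I ≅ M.over U) (hinv : ChartInvariants f τ hτ U)
    (s : Γ((pullback f).obj M, f ⁻¹ᵁ U))
    (hs : ∀ x, (twistAction f τ hτ M x).app U s = s) :
    ∃ m : Γ(M, U), unitSection f M U m = s := by
  classical
  set c : I → Γ(X, f ⁻¹ᵁ U) := fun i => pulledCoord f e (𝟙 (f ⁻¹ᵁ U)) s i with hc
  have hdec := eq_sum_pulledCoord_smul_unitSection f M e s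
  -- each coordinate is invariant, hence descends
  have hci : ∀ i x, twistRingHom f τ hτ U x (c i) = c i := fun i x => by
    have h1 := hs x
    rw [hdec, twistAction_app_sum_smul_unitSection f τ hτ M e x] at h1
    have h2 := congrArg (fun t : Γ((pullback f).obj M, f ⁻¹ᵁ U) => pulledCoord f e (𝟙 (f ⁻¹ᵁ U)) t i) h1
    simp only [pulledCoord_sum_smul_unitSection] at h2
    exact h2
  choose a ha using fun i => hinv (c i) (fun x => hci i x)
  refine ⟨∑ i, a i • basisSection e i, ?_⟩
  rw [unitSection_sum, hdec]
  refine Finset.sum_congr rfl fun i _ => ?_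
  rw [unitSection_smul, ha]

/-- **Uniqueness**: on a framed chart with `f♯_U` injective, `η` is injective on sections — so the descended section is unique and
`(f_*f^*M)^K = η(M) ≅ M` on the chart. [cite: MumfordAV1970, §7 Thm. 4 (p. 72)] -/
theorem unitSection_injective_of_frame (e : SheafOfModules.free I ≅ M.over U) (hinj : Function.Injective (f.app U)) :
    Function.Injective (unitSection f M U) := by
  classical
  intro m m' h
  have key : ∀ n : Γ(M, U), ∀ j, pulledCoord f e (𝟙 (f ⁻¹ᵁ U)) (unitSection f M U n) j = f.app U (coord e (𝟙 U) n j) := by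
    intro n j
    conv_lhs => rw [eq_sum_coord_smul e (𝟙 U) n]
    simp only [op_id, CategoryTheory.Functor.map_id]
    rw [show unitSection f M U (∑ i, coord e (𝟙 U) n i • (𝟙 Γ(M, U) : Γ(M, U) ⟶ Γ(M, U)) (basisSection e i)) =
        ∑ i, f.app U (coord e (𝟙 U) n i) • unitSection f M U (basisSection e i) by
      rw [unitSection_sum]
      exact Finset.sum_congr rfl fun i _ => unitSection_smul f M U _ _]
    exact pulledCoord_sum_smul_unitSection f M e _ j
  have hcoord : ∀ j, coord e (𝟙 U) m j = coord e (𝟙 U) m' j := fun j =>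
    hinj (by rw [← key m j, ← key m' j, h])
  rw [eq_sum_coord_smul e (𝟙 U) m, eq_sum_coord_smul e (𝟙 U) m']
  exact Finset.sum_congr rfl fun j _ => by rw [hcoord j]

end Descent

end Literature.AlgebraicGeometry.Modules
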